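import Mathlib.Analysis.SpecificLimits.Normed
import Mathlib.Analysis.SpecialFunctions.Exp
import Mathlib.Analysis.SpecialFunctions.Pow.Real
import HarnessLib

/-!
# Tools for the polynomial-horizon `L²` locality of the infinite chain: weighted rate arithmetic

Topic `Literature/MathematicalPhysics/KineticTheory` (tools for `InfiniteChainL2LocalityPolynomial`, which re-runs
the fixed-time `L²(μ)` locality of the Buttà–Marchioro flow (`InfiniteChainL2Locality`) keeping the dependence of
the rate on the time window). Elementary real analysis, isolated so that the main file stays short:

* `weighted_sq_geometric_tsum_le` — `Σ_n (1+n)² ρⁿ ≤ 2/(1−ρ)³` for `0 ≤ ρ < 1`;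
* `two_div_one_sub_exp_neg_cube_le` — `2/(1 − e^{−x})³ ≤ 2(1 + 1/x)³` for `x > 0`;
* `mul_sq_le_pow_thirtyTwo`, `lightCone_threshold_decay_le_one` — `1024 n² ≤ 32ⁿ` (`n ≥ 3`) and the decay
  `(2 + bn)·32·32^{−n} ≤ 1` past the linear threshold `b ≤ 16 n`, `n ≥ 3` (the condition `δ_n ≤ 1` of the deterministic
  light cone `InfiniteChainDynamics.exists_abs_sub_comp_severedFlow_le`);
* `summable_weighted_sq_pow_mul_geometric` — `Σ_n (1+n)² n^p 32^{−n} < ∞`;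
* `weighted_twoRegime_rate_tsum_le` — the bookkeeping turning the two-regime rate
  `ε n = E₀` (`n < n₀`), `ε n = Cb n^p 32^{−n} + Cη ρⁿ` (`n ≥ n₀`) into
  `Σ_n (1+n)² ε n ≤ E₀ (1+n₀)³ + Cb S_p + 2 Cη/(1−ρ)³`.

Everything is proved; tagged `[folklore]`. No definitions, no named facts.
-/

noncomputable section

open Filter Set Function
open scoped Topology BigOperators

namespace Literature.MathematicalPhysics.KineticTheory.HeatConduction

/-- Weighted geometric sums: for `0 ≤ ρ < 1`, `n ↦ (1+n)² ρⁿ` is summable and its sum is at most `2/(1−ρ)³`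
(compare with `Σ_n C(n+2,2) ρⁿ = (1−ρ)⁻³`). [folklore] -/
theorem weighted_sq_geometric_tsum_le {ρ : ℝ} (hρ0 : 0 ≤ ρ) (hρ1 : ρ < 1) :
    Summable (fun n : ℕ => (1 + (n : ℝ)) ^ 2 * ρ ^ n) ∧
      (∑' n : ℕ, (1 + (n : ℝ)) ^ 2 * ρ ^ n) ≤ 2 / (1 - ρ) ^ 3 := by
  have hr : ‖ρ‖ < 1 := by rw [Real.norm_eq_abs, abs_of_nonneg hρ0]; exact hρ1
  have hch := hasSum_choose_mul_geometric_of_norm_lt_one 2 hr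
  have hle : ∀ n : ℕ, (1 + (n : ℝ)) ^ 2 * ρ ^ n ≤ 2 * (((n + 2).choose 2 : ℕ) * ρ ^ n) := by
    intro n
    have h1 : ((n + 2).choose 2 : ℝ) = ((n : ℝ) + 2) * ((n : ℝ) + 1) / 2 := by
      rw [Nat.choose_two_right]
      have h2 : (n + 2) * (n + 2 - 1) = (n + 2) * (n + 1) := by
        congr 1
      rw [h2, Nat.cast_div_charZero]
      · push_cast; ring
      · exact (Nat.even_mul_succ_self (n + 1)).two_dvd |>.elim (fun k hk => ⟨k, by nlinarith [hk]⟩)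
    rw [h1]
    have hρn : 0 ≤ ρ ^ n := pow_nonneg hρ0 n
    have h3 : (1 + (n : ℝ)) ^ 2 ≤ 2 * (((n : ℝ) + 2) * ((n : ℝ) + 1) / 2) := by
      nlinarith [(Nat.cast_nonneg n : (0 : ℝ) ≤ n)]
    calc (1 + (n : ℝ)) ^ 2 * ρ ^ n ≤ (2 * (((n : ℝ) + 2) * ((n : ℝ) + 1) / 2)) * ρ ^ n :=
          mul_le_mul_of_nonneg_right h3 hρn
      _ = 2 * (((n : ℝ) + 2) * ((n : ℝ) + 1) / 2 * ρ ^ n) := by ring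
  have hs2 : Summable fun n : ℕ => 2 * (((n + 2).choose 2 : ℕ) * ρ ^ n) := hch.summable.mul_left 2
  have hs : Summable (fun n : ℕ => (1 + (n : ℝ)) ^ 2 * ρ ^ n) :=
    Summable.of_nonneg_of_le (fun n => by positivity) hle hs2
  refine ⟨hs, ?_⟩
  calc (∑' n : ℕ, (1 + (n : ℝ)) ^ 2 * ρ ^ n) ≤ ∑' n : ℕ, 2 * (((n + 2).choose 2 : ℕ) * ρ ^ n) :=
        hs.tsum_le_tsum hle hs2
    _ = 2 * (1 / (1 - ρ) ^ 3) := by rw [tsum_mul_left, hch.tsum_eq]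
    _ = 2 / (1 - ρ) ^ 3 := by ring

/-- `2/(1 − e^{−x})³ ≤ 2(1 + 1/x)³` for `x > 0` (from `1 + x ≤ eˣ`, i.e. `1/(1 − e^{−x}) ≤ 1 + 1/x`; stated in
the cubed form consumed by the weighted geometric bound). [folklore] -/
theorem two_div_one_sub_exp_neg_cube_le {x : ℝ} (hx : 0 < x) :
    2 / (1 - Real.exp (-x)) ^ 3 ≤ 2 * (1 + 1 / x) ^ 3 := by
  have h1 : x + 1 ≤ Real.exp x := Real.add_one_le_exp x
  have hex : Real.exp (-x) = 1 / Real.exp x := by rw [Real.exp_neg, one_div]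
  have h2 : Real.exp (-x) ≤ 1 / (x + 1) := by
    rw [hex]
    exact one_div_le_one_div_of_le (by linarith) h1
  have h3 : x / (x + 1) ≤ 1 - Real.exp (-x) := by
    have : 1 - 1 / (x + 1) = x / (x + 1) := by field_simp; ring
    linarith
  have h4 : 0 < x / (x + 1) := by positivity
  have h5 : 1 / (1 - Real.exp (-x)) ≤ 1 + 1 / x := by
    calc 1 / (1 - Real.exp (-x)) ≤ 1 / (x / (x + 1)) := one_div_le_one_div_of_le h4 h3
      _ = 1 + 1 / x := by field_simp
  have h6 : 0 < 1 - Real.exp (-x) := h4.trans_le h3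
  have h7 : 0 ≤ 1 / (1 - Real.exp (-x)) := by positivity
  calc 2 / (1 - Real.exp (-x)) ^ 3 = 2 * (1 / (1 - Real.exp (-x))) ^ 3 := by
        rw [div_pow, one_pow]; ring
    _ ≤ 2 * (1 + 1 / x) ^ 3 := by
        refine mul_le_mul_of_nonneg_left (pow_le_pow_left₀ h7 h5 3) (by norm_num)

/-- `1024 n² ≤ 32ⁿ` for `n ≥ 3`. [folklore] -/
theorem mul_sq_le_pow_thirtyTwo {n : ℕ} (hn : 3 ≤ n) : (1024 : ℝ) * (n : ℝ) ^ 2 ≤ (32 : ℝ) ^ n := by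
  induction n, hn using Nat.le_induction with
  | base => norm_num
  | succ k hk ih =>
    have hk' : (3 : ℝ) ≤ k := by exact_mod_cast hk
    push_cast
    calc (1024 : ℝ) * ((k : ℝ) + 1) ^ 2 ≤ 32 * (1024 * (k : ℝ) ^ 2) := by nlinarith
      _ ≤ 32 * (32 : ℝ) ^ k := by linarith
      _ = (32 : ℝ) ^ (k + 1) := by rw [pow_succ]; ring

/-- Past the linear threshold (`n ≥ 3` and `b ≤ 16 n`): `(2 + b n)·32·(1/32)ⁿ ≤ 1`. [folklore] -/
theorem lightCone_threshold_decay_le_one {b : ℝ} {n : ℕ} (hn3 : 3 ≤ n) (hbn : b ≤ 16 * (n : ℝ)) :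
    (2 + b * n) * 32 * ((1 : ℝ) / 32) ^ n ≤ 1 := by
  have hpow := mul_sq_le_pow_thirtyTwo hn3
  have hn1 : (1 : ℝ) ≤ n := by
    have : (3 : ℝ) ≤ n := by exact_mod_cast hn3
    linarith
  have h32 : (0 : ℝ) < (32 : ℝ) ^ n := by positivity
  have e : ((1 : ℝ) / 32) ^ n = 1 / (32 : ℝ) ^ n := by rw [div_pow, one_pow]
  rw [e]
  rw [show (2 + b * n) * 32 * (1 / (32 : ℝ) ^ n) = ((2 + b * n) * 32) / (32 : ℝ) ^ n by ring]
  rw [div_le_one h32]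
  have h1 : (2 + b * n) * 32 ≤ 1024 * (n : ℝ) ^ 2 := by
    have h2 : b * n ≤ 16 * (n : ℝ) * n := by
      have := mul_le_mul_of_nonneg_right hbn (by linarith : (0 : ℝ) ≤ n)
      linarith
    have h3 : (64 : ℝ) ≤ 512 * (n : ℝ) ^ 2 := by nlinarith
    calc (2 + b * n) * 32 = 64 + 32 * (b * n) := by ring
      _ ≤ 512 * (n : ℝ) ^ 2 + 32 * (16 * (n : ℝ) * n) := by linarith
      _ = 1024 * (n : ℝ) ^ 2 := by ring
  linarith

/-- A polynomial times a geometric sequence has a summable `(1+n)²`-weighted series: the constant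
`S_p = Σ_n (1+n)² n^p 32^{−n}` is finite. [folklore] -/
theorem summable_weighted_sq_pow_mul_geometric (p : ℕ) :
    Summable (fun n : ℕ => (1 + (n : ℝ)) ^ 2 * ((n : ℝ) ^ p * ((1 : ℝ) / 32) ^ n)) := by
  have hr : ‖((1 : ℝ) / 32)‖ < 1 := by rw [Real.norm_eq_abs, abs_of_pos (by norm_num)]; norm_num
  have h0 := summable_pow_mul_geometric_of_norm_lt_one p hr
  have h1 := summable_pow_mul_geometric_of_norm_lt_one (p + 1) hr
  have h2 := summable_pow_mul_geometric_of_norm_lt_one (p + 2) hr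
  have e : (fun n : ℕ => (1 + (n : ℝ)) ^ 2 * ((n : ℝ) ^ p * ((1 : ℝ) / 32) ^ n)) =
      fun n : ℕ => (n : ℝ) ^ p * ((1 : ℝ) / 32) ^ n + 2 * ((n : ℝ) ^ (p + 1) * ((1 : ℝ) / 32) ^ n) +
        (n : ℝ) ^ (p + 2) * ((1 : ℝ) / 32) ^ n := by
    funext n; ring
  rw [e]
  exact (h0.add (h1.mul_left 2)).add h2

/-- **Bookkeeping of the two-regime rate.** For the rate `ε n = E₀` (`n < n₀`) and
`ε n = Cb n^p 32^{−n} + Cη ρⁿ` (`n ≥ n₀`) with `E₀, Cb, Cη ≥ 0`, `0 ≤ ρ < 1`: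
`n ↦ (1+n)² ε n` is summable and `Σ_n (1+n)² ε n ≤ E₀ (1+n₀)³ + Cb S_p + 2 Cη/(1−ρ)³`, where
`S_p = Σ_n (1+n)² n^p 32^{−n}`. [folklore] -/
theorem weighted_twoRegime_rate_tsum_le {E₀ Cb Cη ρ : ℝ} (hE₀ : 0 ≤ E₀) (hCb : 0 ≤ Cb) (hCη : 0 ≤ Cη)
    (hρ0 : 0 ≤ ρ) (hρ1 : ρ < 1) (p n₀ : ℕ) :
    Summable (fun n : ℕ => (1 + (n : ℝ)) ^ 2 *
        (if n < n₀ then E₀ else Cb * (n : ℝ) ^ p * ((1 : ℝ) / 32) ^ n + Cη * ρ ^ n)) ∧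
      (∑' n : ℕ, (1 + (n : ℝ)) ^ 2 *
          (if n < n₀ then E₀ else Cb * (n : ℝ) ^ p * ((1 : ℝ) / 32) ^ n + Cη * ρ ^ n)) ≤
        E₀ * (1 + (n₀ : ℝ)) ^ 3 + Cb * (∑' n : ℕ, (1 + (n : ℝ)) ^ 2 * ((n : ℝ) ^ p * ((1 : ℝ) / 32) ^ n)) +
          2 * Cη / (1 - ρ) ^ 3 := by
  -- the three summable majorants
  have hA' : Summable fun n : ℕ => (if n < n₀ then (1 + (n : ℝ)) ^ 2 * E₀ else 0) := by
    refine summable_of_ne_finset_zero (s := Finset.range n₀) fun n hn => ?_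
    have hn' : ¬ n < n₀ := by simpa [Finset.mem_range] using hn
    simp [hn']
  have hB := (summable_weighted_sq_pow_mul_geometric p).mul_left Cb
  obtain ⟨hGs, hGb⟩ := weighted_sq_geometric_tsum_le hρ0 hρ1
  have hC := hGs.mul_left Cη
  have hle : ∀ n : ℕ, (1 + (n : ℝ)) ^ 2 *
      (if n < n₀ then E₀ else Cb * (n : ℝ) ^ p * ((1 : ℝ) / 32) ^ n + Cη * ρ ^ n) ≤
      (if n < n₀ then (1 + (n : ℝ)) ^ 2 * E₀ else 0) +
        (Cb * ((1 + (n : ℝ)) ^ 2 * ((n : ℝ) ^ p * ((1 : ℝ) / 32) ^ n)) +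
          Cη * ((1 + (n : ℝ)) ^ 2 * ρ ^ n)) := by
    intro n
    split_ifs with h
    · have : 0 ≤ Cb * ((1 + (n : ℝ)) ^ 2 * ((n : ℝ) ^ p * ((1 : ℝ) / 32) ^ n)) +
          Cη * ((1 + (n : ℝ)) ^ 2 * ρ ^ n) := by positivity
      linarith
    · have : (1 + (n : ℝ)) ^ 2 * (Cb * (n : ℝ) ^ p * ((1 : ℝ) / 32) ^ n + Cη * ρ ^ n) =
          Cb * ((1 + (n : ℝ)) ^ 2 * ((n : ℝ) ^ p * ((1 : ℝ) / 32) ^ n)) +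
            Cη * ((1 + (n : ℝ)) ^ 2 * ρ ^ n) := by ring
      linarith
  have hnn : ∀ n : ℕ, 0 ≤ (1 + (n : ℝ)) ^ 2 *
      (if n < n₀ then E₀ else Cb * (n : ℝ) ^ p * ((1 : ℝ) / 32) ^ n + Cη * ρ ^ n) := by
    intro n
    split_ifs
    · positivity
    · positivity
  have hmaj : Summable fun n : ℕ => (if n < n₀ then (1 + (n : ℝ)) ^ 2 * E₀ else 0) +
      (Cb * ((1 + (n : ℝ)) ^ 2 * ((n : ℝ) ^ p * ((1 : ℝ) / 32) ^ n)) +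
        Cη * ((1 + (n : ℝ)) ^ 2 * ρ ^ n)) := hA'.add (hB.add hC)
  have hs := Summable.of_nonneg_of_le hnn hle hmaj
  refine ⟨hs, (hs.tsum_le_tsum hle hmaj).trans ?_⟩
  rw [hA'.tsum_add (hB.add hC), hB.tsum_add hC, tsum_mul_left, tsum_mul_left]
  -- the finite part
  have hfin : (∑' n : ℕ, (if n < n₀ then (1 + (n : ℝ)) ^ 2 * E₀ else 0)) ≤ E₀ * (1 + (n₀ : ℝ)) ^ 3 := by
    rw [tsum_eq_sum (s := Finset.range n₀) (fun n hn => by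
      have hn' : ¬ n < n₀ := by simpa [Finset.mem_range] using hn
      simp [hn'])]
    calc ∑ n ∈ Finset.range n₀, (if n < n₀ then (1 + (n : ℝ)) ^ 2 * E₀ else 0)
        ≤ ∑ _n ∈ Finset.range n₀, (1 + (n₀ : ℝ)) ^ 2 * E₀ := by
          refine Finset.sum_le_sum fun n hn => ?_
          have hn' : n < n₀ := Finset.mem_range.1 hn
          rw [if_pos hn']
          have : (n : ℝ) ≤ n₀ := by exact_mod_cast hn'.le
          have h1 : (1 + (n : ℝ)) ^ 2 ≤ (1 + (n₀ : ℝ)) ^ 2 := by gcongr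
          exact mul_le_mul_of_nonneg_right h1 hE₀
      _ = n₀ * ((1 + (n₀ : ℝ)) ^ 2 * E₀) := by rw [Finset.sum_const, Finset.card_range, nsmul_eq_mul]
      _ ≤ (1 + (n₀ : ℝ)) * ((1 + (n₀ : ℝ)) ^ 2 * E₀) := by
          refine mul_le_mul_of_nonneg_right (by linarith) (by positivity)
      _ = E₀ * (1 + (n₀ : ℝ)) ^ 3 := by ring
  have hgeo : Cη * (∑' n : ℕ, (1 + (n : ℝ)) ^ 2 * ρ ^ n) ≤ 2 * Cη / (1 - ρ) ^ 3 := by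
    calc Cη * (∑' n : ℕ, (1 + (n : ℝ)) ^ 2 * ρ ^ n) ≤ Cη * (2 / (1 - ρ) ^ 3) :=
          mul_le_mul_of_nonneg_left hGb hCη
      _ = 2 * Cη / (1 - ρ) ^ 3 := by ring
  linarith

end Literature.MathematicalPhysics.KineticTheory.HeatConduction

end
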